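import Literature.IUT.LogThetaLattice.ThetaLinkOfKits
import Literature.IUT.LogThetaLattice.StripFrameOfKitsFullness
import Literature.IUT.LogThetaLattice.TimesMuSideOfStrips
import HarnessLib

/-!
# `ThetaLinkKit.ofPilots`: the [IUTchII] Cor 4.10 kit from the PILOTS ALONE — its clause (iv) «coincides with the full
# poly-isomorphism» is DISCHARGED by the iso-surjectivity of `F^{⊩▶×μ} ↦ F^{⊢×μ}` (abc-iut cell, layer L6; seat
# abc-iut-w4-d028, lineage of `StripFrameOfKitsFullness` / GAP G-w4d028-1; for abc-iut-L6-t3's `LatticeGlue.ofKits` p419606)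

S. Mochizuki, *Inter-universal Teichmüller theory II*, kurims Dec-2020 manuscript, Cor 4.10 (i)–(iv) pp. 158–160
(«one obtains a poly-isomorphism `†F^{⊢×μ}_△ ⥲ ‡F^{⊢×μ}_△` which coincides with the full poly-isomorphism»); *III*, kurims
May-2020 manuscript, Thm 1.5 (ii) p. 48. [cite: Mochizuki2012, Cor 4.10 (iv) p.160] Claim key DISPUTED (D-0012): nothing
here asserts a disputed claim or takes a side on [IUTchIII] Cor 3.12; interface plumbing only.

abc-iut-L6-t3's `ThetaLinkKit X` (`ThetaLinkOfKits`, p413818) carries [IUTchII] Cor 4.10 (iv) as a kit-level INPUT field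
`induced_full`, and `LatticeGlue.ofKits`/`LatticeGlue.ofPassages` (`LatticeGlueOfKits`, p419606) take a `ThetaLinkKit` as
given. But under the ONE iso-surjectivity hypothesis `h` on the Def 4.9 input that those constructors ALREADY take (for
[IUTchIII] Thm 2.2 (i)), the clause follows for ANY pair of pilot functors — this seat's
`TimesMuSide.induced_full_of_mapIso_surjective` (`StripFrameOfKitsFullness`, p415287) — and over
`TimesMuSide.ofPassages` the hypothesis is abc-iut-L6-t3's theorem `TimesMuSide.ofPassages_mapIso_surjective`
(`TimesMuSideOfStrips`, p417223). This file packages that: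

* `ThetaLinkKit.ofPilots X h pilotDelta pilotTheta unitPortion` — a `ThetaLinkKit` from the pilots `†ℋ𝒯 ↦ †𝔉^{⊩▶×μ}_△`
  [Cor 4.10 (i)], `†ℋ𝒯 ↦ †𝔉^{⊩▶×μ}_{env/gau}` [Cor 4.10 (ii)] and the unit-portion identifications [Cor 4.10 (iv), first
  clause] ONLY, `induced_full` := the theorem;
* `ThetaLinkKit.ofPilotsPassages` — the same over `TimesMuSide.ofPassages L hR Ps` with NO [IUTchII]-side hypothesis;
* `ThetaLinkKit.nonempty_of_pilots(_passages)` — hence `ThetaLinkKit` is inhabited as soon as pilots and unit-portion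
  isomorphisms are given (no Cor 4.10 (iv) input);
so that in `LatticeGlue.ofKits … h Gk` the field `Gk.linkKit` can be taken `:= ThetaLinkKit.ofPilots X h …`, and
[IUTchIII] Thm 1.5 (ii) joins Thm 2.2 (i) as DISCHARGED at the real frame (only pilots + unit-portion isos remain as
[IUTchII] Cor 4.10 (i)–(iii) inputs BY NAME). Deliberately NOT here: any pilot functor (owners abc-iut-L6-t2 / L6-t1:
the Θ- and q-pilot objects of [IUTchII] Cor 4.10 (i)(ii) over the kits), any change to the landed files.
-/

namespace Literature.IUT.LogThetaLattice

open CategoryTheory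
open Literature.IUT.HodgeTheaters Literature.IUT.HodgeTheaters.PMBaseKit
open Literature.IUT.HodgeArakelov

universe u v w

section Kit

variable {l : ℕ} {K : PMBaseKit.{u} l} {M : K.MultKit} {FK : K.FKit M} (L : FK.MonoLaws) (X : TimesMuSide FK L)

/-- **IUTchII:Cor4.10(iv)** (kurims p.160) **`ThetaLinkKit.ofPilots`** — the [IUTchII] Cor 4.10 kit of abc-iut-L6-t3's
`ThetaLinkOfKits` built from the pilot functors [Cor 4.10 (i)(ii)] and the unit-portion natural isomorphisms [Cor 4.10
(iv), first clause] ALONE: the clause «which coincides with the full poly-isomorphism» (`induced_full`) is the theorem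
`TimesMuSide.induced_full_of_mapIso_surjective` under the iso-surjectivity `h` of `F^{⊩▶×μ} ↦ F^{⊢▶×μ} ↦ F^{⊢×μ}` on the
Def 4.9 input (the SAME `h` as in `ThetaMonoidData.ofKits` / `LatticeGlue.ofKits`). [claim: Mochizuki2012, status: disputed] -/
noncomputable def ThetaLinkKit.ofPilots
    (h : ∀ A B : X.Fglxm, Function.Surjective (fun g : A ≅ B => (X.FglxmToFvtxm ⋙ X.FvtxmToFxm).mapIso g))
    (pilotDelta : HTRep FK ⥤ X.Fglxm) (pilotTheta : LatticeKind → (HTRep FK ⥤ X.Fglxm))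
    (unitPortion : ∀ k : LatticeKind,
      pilotDelta ⋙ (X.FglxmToFvtxm ⋙ X.FvtxmToFxm) ≅ pilotTheta k ⋙ (X.FglxmToFvtxm ⋙ X.FvtxmToFxm)) :
    ThetaLinkKit X where
  pilotDelta := pilotDelta
  pilotTheta := pilotTheta
  unitPortion := unitPortion
  induced_full k H H' := TimesMuSide.induced_full_of_mapIso_surjective L X h (pilotTheta k) pilotDelta H H'

/-- **IUTchII:Cor4.10(i)** (kurims p.158) The kit `ofPilots` has the given `△`-pilot (by construction).
[claim: Mochizuki2012, status: disputed] -/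
theorem ThetaLinkKit.ofPilots_pilotDelta
    (h : ∀ A B : X.Fglxm, Function.Surjective (fun g : A ≅ B => (X.FglxmToFvtxm ⋙ X.FvtxmToFxm).mapIso g))
    (pilotDelta : HTRep FK ⥤ X.Fglxm) (pilotTheta : LatticeKind → (HTRep FK ⥤ X.Fglxm))
    (unitPortion : ∀ k : LatticeKind,
      pilotDelta ⋙ (X.FglxmToFvtxm ⋙ X.FvtxmToFxm) ≅ pilotTheta k ⋙ (X.FglxmToFvtxm ⋙ X.FvtxmToFxm)) :
    (ThetaLinkKit.ofPilots L X h pilotDelta pilotTheta unitPortion).pilotDelta = pilotDelta := rfl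

/-- **IUTchII:Cor4.10(ii)** (kurims p.159) The kit `ofPilots` has the given Θ-pilots (by construction).
[claim: Mochizuki2012, status: disputed] -/
theorem ThetaLinkKit.ofPilots_pilotTheta
    (h : ∀ A B : X.Fglxm, Function.Surjective (fun g : A ≅ B => (X.FglxmToFvtxm ⋙ X.FvtxmToFxm).mapIso g))
    (pilotDelta : HTRep FK ⥤ X.Fglxm) (pilotTheta : LatticeKind → (HTRep FK ⥤ X.Fglxm))
    (unitPortion : ∀ k : LatticeKind,
      pilotDelta ⋙ (X.FglxmToFvtxm ⋙ X.FvtxmToFxm) ≅ pilotTheta k ⋙ (X.FglxmToFvtxm ⋙ X.FvtxmToFxm)) (k : LatticeKind) :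
    (ThetaLinkKit.ofPilots L X h pilotDelta pilotTheta unitPortion).pilotTheta k = pilotTheta k := rfl

/-- **IUTchII:Cor4.10(iv)** (kurims p.160) NON-VACUITY of abc-iut-L6-t3's `ThetaLinkKit X` from pilots alone: given the
iso-surjectivity `h`, ANY pilot functors with unit-portion identifications give a kit (no Cor 4.10 (iv) input).
[claim: Mochizuki2012, status: disputed] -/
theorem ThetaLinkKit.nonempty_of_pilots
    (h : ∀ A B : X.Fglxm, Function.Surjective (fun g : A ≅ B => (X.FglxmToFvtxm ⋙ X.FvtxmToFxm).mapIso g))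
    (pilotDelta : HTRep FK ⥤ X.Fglxm) (pilotTheta : LatticeKind → (HTRep FK ⥤ X.Fglxm))
    (unitPortion : ∀ k : LatticeKind,
      pilotDelta ⋙ (X.FglxmToFvtxm ⋙ X.FvtxmToFxm) ≅ pilotTheta k ⋙ (X.FglxmToFvtxm ⋙ X.FvtxmToFxm)) :
    Nonempty (ThetaLinkKit X) :=
  ⟨ThetaLinkKit.ofPilots L X h pilotDelta pilotTheta unitPortion⟩

end Kit

/-! ### Over `TimesMuSide.ofPassages`: no [IUTchII]-side hypothesis -/

section OfPassages

variable {l : ℕ} {K : PMBaseKit.{max (v + 1) w} l} {M : K.MultKit} {FK : K.FKit M}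
  {P : PlaceData K.V} {G : K.V → Type} [∀ v, Group (G v)]
  {X : ∀ v, GroupTheoreticUnits.{0, w} (G v)} {S₀ : FVdashSplitTriMuPrimeStrip.{0, v, w} P G X}
  (L : FK.MonoLaws) (hR : FK.RlfOfIsStrip) (Ps : TimesMuPassages FK S₀)

/-- **IUTchII:Cor4.10(iv)** (kurims p.160) **`ThetaLinkKit.ofPilotsPassages`** — over the real frame built on abc-iut-L6-t2's
print-level strip groupoids (`TimesMuSide.ofPassages L hR Ps`), the Cor 4.10 kit from pilots + unit-portion isomorphisms
with NO hypothesis on the [IUTchII] side: the clause (iv) is abc-iut-L6-t3's theorem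
`TimesMuSide.ofPassages_mapIso_surjective` fed into `ofPilots`. [claim: Mochizuki2012, status: disputed] -/
noncomputable def ThetaLinkKit.ofPilotsPassages
    (pilotDelta : HTRep FK ⥤ (TimesMuSide.ofPassages L hR Ps).Fglxm)
    (pilotTheta : LatticeKind → (HTRep FK ⥤ (TimesMuSide.ofPassages L hR Ps).Fglxm))
    (unitPortion : ∀ k : LatticeKind,
      pilotDelta ⋙ ((TimesMuSide.ofPassages L hR Ps).FglxmToFvtxm ⋙ (TimesMuSide.ofPassages L hR Ps).FvtxmToFxm) ≅
        pilotTheta k ⋙ ((TimesMuSide.ofPassages L hR Ps).FglxmToFvtxm ⋙ (TimesMuSide.ofPassages L hR Ps).FvtxmToFxm)) :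
    ThetaLinkKit (TimesMuSide.ofPassages L hR Ps) :=
  ThetaLinkKit.ofPilots L _ (TimesMuSide.ofPassages_mapIso_surjective L hR Ps) pilotDelta pilotTheta unitPortion

/-- **IUTchIII:Thm1.5(ii)** (kurims p.48) Hence over the print-level groupoids abc-iut-L6-t3's `ThetaLinkKit` — the input
through which `LatticeGlue.ofPassages` receives [IUTchII] Cor 4.10 (iv) / [IUTchIII] Thm 1.5 (ii) — is INHABITED from
pilots and unit-portion isomorphisms alone: Thm 1.5 (ii) is DISCHARGED at the real frame, like Thm 2.2 (i).
[claim: Mochizuki2012, status: disputed] -/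
theorem ThetaLinkKit.nonempty_of_pilots_passages
    (pilotDelta : HTRep FK ⥤ (TimesMuSide.ofPassages L hR Ps).Fglxm)
    (pilotTheta : LatticeKind → (HTRep FK ⥤ (TimesMuSide.ofPassages L hR Ps).Fglxm))
    (unitPortion : ∀ k : LatticeKind,
      pilotDelta ⋙ ((TimesMuSide.ofPassages L hR Ps).FglxmToFvtxm ⋙ (TimesMuSide.ofPassages L hR Ps).FvtxmToFxm) ≅
        pilotTheta k ⋙ ((TimesMuSide.ofPassages L hR Ps).FglxmToFvtxm ⋙ (TimesMuSide.ofPassages L hR Ps).FvtxmToFxm)) :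
    Nonempty (ThetaLinkKit (TimesMuSide.ofPassages L hR Ps)) :=
  ⟨ThetaLinkKit.ofPilotsPassages L hR Ps pilotDelta pilotTheta unitPortion⟩

end OfPassages

end Literature.IUT.LogThetaLattice
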